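import Summits.RiemannHypothesis.RiemannHypothesis.Theses.GapsEvoDoors
import Summits.RiemannHypothesis.RiemannHypothesis.Theorems.GapsEvoDoorsFFWindow
import Summits.RiemannHypothesis.RiemannHypothesis.Theorems.GapsEvoDoorsWindowPairCount

/-!
# GapsEvoDoors — `FFMultiplicityCriterionAll` (item stmt-RiemannHypothesis-23129): the door-(a″) multiplicity criterion

Route `GapsEvoDoors`, support `FFMultiplicityCriterionAll` («Δ_s», PREREG-GAPS-7 / ADDENDUM E11):
for every `Δ ≥ 1`, `ε ≥ 0`, the fragment `|F(α,T) − 1| ≤ ε` on `1 < |α| ≤ Δ` (all large `T`) and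
RH give, for every admissible multiplicity majorant `g` (even, continuous, `L¹`, `ĝ ∈ L¹`,
`g ≥ 0`, `g(0) = 1`, `ĝ ≤ 0` for `|α| ≥ Δ`) and every `η > 0`, eventually
`N*(T) = Σ_{γ_d ≤ T} m(γ_d)² ≤ (m(g;Δ,ε) + η) N(T)`,
`m(g;Δ,ε) = ĝ(0) + 2∫₀¹ α ĝ + 2∫₁^Δ ((1 + ε) ĝ⁺ − (1 − ε) ĝ⁻)` — Montgomery's 1973
pair-correlation argument for `Σ m_ρ²` (his `N* ≤ (4/3 + o(1))N` is `Δ = 1` with the Fejér pair)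
in the Bui–Goldston–Milinovich–Montgomery 2023 Proposition-1 scheme, with the fragment:

* the explicit formula `Σ_{γ,γ'} g((γ−γ')log T/2π) w(γ−γ') = (T/2π) log T ∫ F ĝ` (tree
  `AH.sum_fourier_pairSpacing_eq_integral` with Fourier inversion `𝓕ĝ = g` from `ĝ ∈ L¹`, tree
  `Theorems.GapsEvoDoorsWindow.fourier_cosTransform_eq_of_integrable`); the diagonal blocks
  `γ = γ'` contribute `g(0) w(0) = 1` each and `g ≥ 0`, `w > 0`, so the left side is `≥ N*(T)`
  (`multPairCount T`);
* `∫_ℝ F ĝ ≤ ∫_{−Δ}^{Δ} F ĝ` (`F ≥ 0`, `ĝ ≤ 0` beyond `Δ`); on `1 < |α| ≤ Δ`,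
  `F ĝ ≤ (1 + ε) ĝ⁺ − (1 − ε) ĝ⁻` pointwise (`F ∈ [1 − ε, 1 + ε]`, `F ≥ 0`), `F(−α) = F(α)`; on
  `[−1, 1]` the SIGNED two-sided Montgomery theorem of `GapsEvoDoorsFFWindow.lean`
  (`window_integral_ge`, applied to `−ĝ`): `∫_{−1}^{1} F ĝ ≤ ĝ(0) + ∫_{−1}^{1} |α| ĝ + η₁(2 + 7‖g‖₁)`;
* `N(T) ∼ (T/2π) log T` (tree `RudnickSarnak.tendsto_zetaZeroCount_div_main`).

RH is the antecedent. RH-sentence (c): a record INSIDE route GapsEvoDoors (door (a″), RECORD class)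
— toward RiemannHypothesis: 0. Nothing here bears on the truth of RH.
-/

noncomputable section

open Filter Set MeasureTheory Real Finset Literature.NumberTheory.LFunctions
open Literature.NumberTheory.LFunctions.BGMM2023
open Summit.RiemannHypothesis.RiemannHypothesis.Theorems.GapsEvoDoorsWindow
open scoped Topology FourierTransform

set_option linter.dupNamespace false  -- the mandated namespace repeats `RiemannHypothesis`

namespace Summit.RiemannHypothesis.RiemannHypothesis.Theorems.GapsEvoDoorsFF

/-- **The two-sided majorant.** If `|F − 1| ≤ ε` and `F ≥ 0`, then
`F x ≤ (1 + ε) max(x,0) − (1 − ε) max(−x,0)` for every real `x`. -/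
theorem mul_le_twoSided_majorant {F ε x : ℝ} (hF : |F - 1| ≤ ε) (hF0 : 0 ≤ F) :
    F * x ≤ (1 + ε) * max x 0 - (1 - ε) * max (-x) 0 := by
  obtain ⟨h1, h2⟩ := abs_le.1 hF
  rcases le_or_gt 0 x with h0 | h0
  · rw [max_eq_left h0, max_eq_right (by linarith), mul_zero, sub_zero]
    exact mul_le_mul_of_nonneg_right (by linarith) h0
  · rw [max_eq_right h0.le, max_eq_left (by linarith), mul_zero, zero_sub]
    have := mul_le_mul_of_nonpos_right (by linarith : 1 - ε ≤ F) h0.le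
    have hF0' := hF0
    linarith

/-- **Montgomery's `N*` argument under the fragment** (the pair count from ABOVE). Assume RH,
`1 ≤ Δ`, and `|F(α,T) − 1| ≤ ε` on `1 < |α| ≤ Δ` for all large `T`. Let `g` be even, continuous,
`L¹` with `ĝ ∈ L¹`, `g ≥ 0`, `g(0) = 1`, `ĝ(α) ≤ 0` for `|α| ≥ Δ`, and `η > 0`. Then for all large
`T`, `Σ_{γ_d ≤ T} m(γ_d)² ≤ (ĝ(0) + 2∫₀¹ α ĝ + 2∫₁^Δ ((1 + ε) ĝ⁺ − (1 − ε) ĝ⁻) + η) N(T)`. -/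
theorem multPairCount_le_of_fragment (hRH : _root_.RiemannHypothesis) {Δ ε : ℝ} (hΔ : 1 ≤ Δ)
    (hFF : ∃ T₀ : ℝ, ∀ T : ℝ, T₀ ≤ T → ∀ α : ℝ, 1 < |α| → |α| ≤ Δ →
      |montgomeryFormFactor α T - 1| ≤ ε)
    {g : ℝ → ℝ} (heven : ∀ u : ℝ, g (-u) = g u) (hgc : Continuous g) (hgi : Integrable g)
    (hti : Integrable (cosTransform g)) (hg0 : ∀ u : ℝ, 0 ≤ g u) (hg1 : g 0 = 1)
    (htail : ∀ α : ℝ, Δ ≤ |α| → cosTransform g α ≤ 0) {η : ℝ} (hη : 0 < η) :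
    ∃ T₀ : ℝ, ∀ T : ℝ, T₀ ≤ T →
      (multPairCount T : ℝ) ≤ (cosTransform g 0 + 2 * (∫ α in (0 : ℝ)..1, α * cosTransform g α) +
        2 * (∫ α in (1 : ℝ)..Δ, ((1 + ε) * max (cosTransform g α) 0 -
          (1 - ε) * max (-cosTransform g α) 0)) + η) * zetaZeroCount T := by
  classical
  -- the test-function data: `h = ĝ` (signed), `𝓕h = g`
  set h : ℝ → ℝ := cosTransform g with hhdef
  obtain ⟨m, hmdef⟩ : ∃ m : ℝ, m = cosTransform g 0 +
      2 * (∫ α in (0 : ℝ)..1, α * cosTransform g α) +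
      2 * (∫ α in (1 : ℝ)..Δ, ((1 + ε) * max (cosTransform g α) 0 -
        (1 - ε) * max (-cosTransform g α) 0)) := ⟨_, rfl⟩
  rw [← hmdef]
  have hhe : ∀ a, h (-a) = h a := cosTransform_neg g
  have hhc : Continuous h := continuous_cosTransform heven hgi
  set B : ℝ := ∫ u, |g u| with hBdef
  have hhB : ∀ a, |h a| ≤ B := abs_cosTransform_le hgi
  have hB0 : 0 ≤ B := (abs_nonneg _).trans (hhB 0)
  have hnhc : Continuous fun a ↦ -h a := hhc.neg
  have hnhB : ∀ a, |(-h a)| ≤ B := fun a ↦ by rw [abs_neg]; exact hhB a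
  have hFg : ∀ x, 𝓕 (fun a : ℝ ↦ (h a : ℂ)) x = (g x : ℂ) :=
    fourier_cosTransform_eq_of_integrable hgc hgi heven hti
  have hψc : Continuous fun a : ℝ ↦ (1 + ε) * max (h a) 0 - (1 - ε) * max (-h a) 0 :=
    (continuous_const.mul (hhc.max continuous_const)).sub
      (continuous_const.mul (hhc.neg.max continuous_const))
  -- the tolerance `η₁`
  set D : ℝ := 3 + |m| + 7 * B + η with hDdef
  have hD0 : 0 < D := by positivity
  set η₁ : ℝ := min (η / D) (1 / 2) with hη₁def
  have hη₁0 : 0 < η₁ := lt_min (div_pos hη hD0) (by norm_num)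
  have hη₁1 : η₁ ≤ 1 / 2 := min_le_right _ _
  have hη₁D : η₁ * D ≤ η := by
    calc η₁ * D ≤ η / D * D := mul_le_mul_of_nonneg_right (min_le_left _ _) hD0.le
      _ = η := div_mul_cancel₀ η hD0.ne'
  -- Montgomery on `[−1, 1]` against `−ĝ`, the zero count, the fragment
  have hwin := window_integral_ge hRH hnhc hnhB hη₁0 hη₁1
  have hN := RudnickSarnak.tendsto_zetaZeroCount_div_main
  obtain ⟨T_F, hT_F⟩ := hFF
  have hev : ∀ᶠ T : ℝ in atTop, (multPairCount T : ℝ) ≤ (m + η) * zetaZeroCount T := by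
    filter_upwards [hwin, eventually_gt_atTop (1 : ℝ),
      hN.eventually (lt_mem_nhds (show (1 : ℝ) - η₁ < 1 by linarith)),
      eventually_ge_atTop T_F] with T hWin hT1 hNT hTF
    have hT0 : 0 < T := by linarith
    set L : ℝ := Real.log T with hLdef
    have hL : 0 < L := Real.log_pos hT1
    set M : ℝ := T / (2 * π) * L with hMdef
    have hM : 0 < M := by positivity
    -- Step A: the explicit formula, `Σ g(x_p) w_p = M ∫ F ĝ`
    have hA : ∑ p ∈ zeroIndexSet T ×ˢ zeroIndexSet T,
        g (AH.pairSpacing T p) * montgomeryWeight (zetaOrdinate p.1 - zetaOrdinate p.2) =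
        M * ∫ a, montgomeryFormFactor a T * h a := by
      have h1 := AH.sum_fourier_pairSpacing_eq_integral h hti hT1
      simp_rw [hFg] at h1
      exact_mod_cast h1
    -- Step B: the diagonal blocks, `N*(T) ≤ Σ g(x_p) w_p`
    have hBnd : (multPairCount T : ℝ) ≤ ∑ p ∈ zeroIndexSet T ×ˢ zeroIndexSet T,
        g (AH.pairSpacing T p) * montgomeryWeight (zetaOrdinate p.1 - zetaOrdinate p.2) := by
      unfold multPairCount zeroIndexSet
      rw [Finset.card_filter]
      push_cast
      refine Finset.sum_le_sum fun p _ ↦ ?_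
      split_ifs with hP
      · have hx : AH.pairSpacing T p = 0 := by
          rw [AH.pairSpacing, hP, sub_self, zero_mul, zero_div]
        have hw : montgomeryWeight (zetaOrdinate p.1 - zetaOrdinate p.2) = 1 := by
          rw [hP, sub_self, montgomeryWeight]; norm_num
        rw [hx, hg1, hw, one_mul]
      · exact mul_nonneg (hg0 _) (montgomeryWeight_pos _).le
    -- Step C: `∫ F ĝ ≤ m + η₁(2 + 7B)`
    have hFc : Continuous fun a : ℝ ↦ montgomeryFormFactor a T := by
      unfold montgomeryFormFactor; fun_prop
    have hF0 : ∀ a, 0 ≤ montgomeryFormFactor a T := fun a ↦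
      Montgomery.montgomeryFormFactor_nonneg a hT1
    have hFhi : Integrable fun a ↦ montgomeryFormFactor a T * h a :=
      hti.bdd_mul (c := |2 * π / (T * Real.log T)| * ((zeroIndexSet T ×ˢ zeroIndexSet T).card : ℝ))
        hFc.aestronglyMeasurable
        (Eventually.of_forall fun a ↦ by rw [Real.norm_eq_abs]; exact abs_montgomeryFormFactor_le a T)
    have hFhc : Continuous fun a ↦ montgomeryFormFactor a T * h a := hFc.mul hhc
    have hii : ∀ a b : ℝ, IntervalIntegrable (fun a ↦ montgomeryFormFactor a T * h a) volume a b :=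
      fun a b ↦ hFhc.intervalIntegrable _ _
    -- (C0) beyond the window: `∫_ℝ F ĝ ≤ ∫_{−Δ}^{Δ} F ĝ`
    have hC0 : ∫ a, montgomeryFormFactor a T * h a ≤
        ∫ a in (-Δ)..Δ, montgomeryFormFactor a T * h a := by
      rw [intervalIntegral.integral_of_le (by linarith : -Δ ≤ Δ),
        ← integral_add_compl (measurableSet_Ioc : MeasurableSet (Set.Ioc (-Δ) Δ)) hFhi]
      have h0 : ∫ a in (Set.Ioc (-Δ) Δ)ᶜ, montgomeryFormFactor a T * h a ≤ 0 := by
        refine setIntegral_nonpos measurableSet_Ioc.compl fun a ha ↦ ?_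
        have ha' : Δ ≤ |a| := by
          rw [Set.mem_compl_iff, Set.mem_Ioc, not_and_or, not_lt, not_le] at ha
          rcases ha with h' | h'
          · rw [abs_of_nonpos (by linarith)]; linarith
          · rw [abs_of_pos (by linarith)]; exact h'.le
        exact mul_nonpos_of_nonneg_of_nonpos (hF0 a) (htail a ha')
      linarith
    -- (C1) `[−Δ, Δ] = [−Δ, −1] ∪ [−1, 1] ∪ [1, Δ]`, and `∫_{−Δ}^{−1} F ĝ = ∫_1^Δ F ĝ`
    have hsplit : ∫ a in (-Δ)..Δ, montgomeryFormFactor a T * h a =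
        (∫ a in (-Δ)..(-1), montgomeryFormFactor a T * h a) +
        (∫ a in (-1 : ℝ)..1, montgomeryFormFactor a T * h a) +
        (∫ a in (1 : ℝ)..Δ, montgomeryFormFactor a T * h a) := by
      rw [intervalIntegral.integral_add_adjacent_intervals (hii _ _) (hii _ _),
        intervalIntegral.integral_add_adjacent_intervals (hii _ _) (hii _ _)]
    have hsymm : ∫ a in (-Δ)..(-1), montgomeryFormFactor a T * h a =
        ∫ a in (1 : ℝ)..Δ, montgomeryFormFactor a T * h a := by
      rw [← intervalIntegral.integral_comp_neg (fun a ↦ montgomeryFormFactor a T * h a)]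
      refine intervalIntegral.integral_congr fun a _ ↦ ?_
      simp only [montgomeryFormFactor_neg, hhe]
    -- (C2) the fragment on `(1, Δ)`: `F ĝ ≤ (1 + ε) ĝ⁺ − (1 − ε) ĝ⁻`
    have hC2 : ∫ a in (1 : ℝ)..Δ, montgomeryFormFactor a T * h a ≤
        ∫ a in (1 : ℝ)..Δ, ((1 + ε) * max (h a) 0 - (1 - ε) * max (-h a) 0) := by
      refine intervalIntegral.integral_mono_on_of_le_Ioo hΔ (hii _ _) (hψc.intervalIntegrable _ _)
        fun a ha ↦ ?_
      have ha0 : 0 < a := by linarith [ha.1]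
      have ha1 : 1 < |a| := by rw [abs_of_pos ha0]; exact ha.1
      have haΔ : |a| ≤ Δ := by rw [abs_of_pos ha0]; exact ha.2.le
      exact mul_le_twoSided_majorant (hT_F T hTF a ha1 haΔ) (hF0 a)
    -- (C3) `[−1, 1]`: `∫ F ĝ ≤ ĝ(0) + ∫ |α| ĝ + η₁(2 + 7B)` (`window_integral_ge` for `−ĝ`)
    have hC3 : ∫ a in (-1 : ℝ)..1, montgomeryFormFactor a T * h a ≤
        h 0 + (∫ a in (-1 : ℝ)..1, |a| * h a) + η₁ * (2 + 7 * B) := by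
      have e1 : ∫ a in (-1 : ℝ)..1, montgomeryFormFactor a T * -h a =
          -∫ a in (-1 : ℝ)..1, montgomeryFormFactor a T * h a := by
        rw [← intervalIntegral.integral_neg]
        refine intervalIntegral.integral_congr fun a _ ↦ ?_
        simp only [mul_neg]
      have e2 : ∫ a in (-1 : ℝ)..1, |a| * -h a = -∫ a in (-1 : ℝ)..1, |a| * h a := by
        rw [← intervalIntegral.integral_neg]
        refine intervalIntegral.integral_congr fun a _ ↦ ?_
        simp only [mul_neg]
      have h1 := hWin
      rw [e1, e2] at h1
      linarith
    have hY : ∫ a in (-1 : ℝ)..1, |a| * h a = 2 * ∫ a in (0 : ℝ)..1, a * h a :=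
      integral_abs_mul_of_even hhe hhc
    have hInt : ∫ a, montgomeryFormFactor a T * h a ≤ m + η₁ * (2 + 7 * B) := by
      linarith only [hC0, hsplit, hsymm, hC2, hC3, hY, hmdef]
    -- `N*(T) ≤ M (m + η₁(2 + 7B))` and `(1 − η₁) M ≤ N(T)`
    have hP2 : (multPairCount T : ℝ) ≤ M * (m + η₁ * (2 + 7 * B)) := by
      calc (multPairCount T : ℝ) ≤ _ := hBnd
        _ = M * ∫ a, montgomeryFormFactor a T * h a := hA
        _ ≤ M * (m + η₁ * (2 + 7 * B)) := mul_le_mul_of_nonneg_left hInt hM.le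
    have hNM : (1 - η₁) * M ≤ (zetaZeroCount T : ℝ) := by
      have h1 : 1 - η₁ < (zetaZeroCount T : ℝ) / (T / (2 * π) * Real.log T) := hNT
      rw [lt_div_iff₀ hM] at h1
      exact h1.le
    -- conclusion
    have hm0 : 0 ≤ m + η₁ * (2 + 7 * B) := by
      by_contra hneg
      push Not at hneg
      have h1 : M * (m + η₁ * (2 + 7 * B)) < 0 := mul_neg_of_pos_of_neg hM hneg
      have h2 : (0 : ℝ) ≤ multPairCount T := Nat.cast_nonneg _
      linarith
    have h2 : m + η₁ * (2 + 7 * B) ≤ (1 - η₁) * (m + η) := by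
      have h3 : η₁ * m ≤ η₁ * |m| := mul_le_mul_of_nonneg_left (le_abs_self m) hη₁0.le
      have h4 : η₁ * D = η₁ * (3 + |m| + 7 * B + η) := by rw [hDdef]
      nlinarith [h3, h4, hη₁D, hη₁0.le, hη.le]
    have hmη : 0 ≤ m + η := by
      by_contra hneg
      push Not at hneg
      have : (1 - η₁) * (m + η) < 0 := mul_neg_of_pos_of_neg (by linarith) hneg
      linarith
    calc (multPairCount T : ℝ) ≤ M * (m + η₁ * (2 + 7 * B)) := hP2
      _ ≤ M * ((1 - η₁) * (m + η)) := mul_le_mul_of_nonneg_left h2 hM.le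
      _ = ((1 - η₁) * M) * (m + η) := by ring
      _ ≤ (zetaZeroCount T : ℝ) * (m + η) := mul_le_mul_of_nonneg_right hNM hmη
      _ = (m + η) * zetaZeroCount T := by ring
  obtain ⟨T₀, hT₀⟩ := eventually_atTop.1 hev
  exact ⟨T₀, hT₀⟩

/-- **`FFMultiplicityCriterionAll` holds** (item stmt-RiemannHypothesis-23129 of route GapsEvoDoors):
the door-(a″) multiplicity criterion — for every `Δ ≥ 1`, `ε ≥ 0`, the fragment on `1 < |α| ≤ Δ`
and RH bound `N*(T)` by `(m(g;Δ,ε) + η) N(T)` eventually, for every admissible majorant `g` and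
every `η > 0` (`multPairCount_le_of_fragment`). A record INSIDE the route (door (a″), RECORD
class); toward RiemannHypothesis: 0. -/
theorem FFMultiplicityCriterionAll_holds :
    Summit.RiemannHypothesis.RiemannHypothesis.Theses.GapsEvoDoors.FFMultiplicityCriterionAll := by
  unfold Summit.RiemannHypothesis.RiemannHypothesis.Theses.GapsEvoDoors.FFMultiplicityCriterionAll
  intro Δ ε hΔ _hε hFF hRH g hev hco hin hti hg0 hg1 htail η hη
  exact multPairCount_le_of_fragment hRH hΔ hFF hev hco hin hti hg0 hg1 htail hη

end Summit.RiemannHypothesis.RiemannHypothesis.Theorems.GapsEvoDoorsFF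

end
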